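import Mathlib.Analysis.SpecialFunctions.Exp
import Mathlib.Analysis.SpecialFunctions.Log.Basic
import Mathlib.Tactic
import HarnessLib

/-!
# Crux RED split, glue item `TraceDoorGlue` (stmt-QuantumFields-20206): the ENCLOSURE ALGEBRA of the Kato–Temple door (skeleton «KTR» PART 3 §4)

Route `LuscherReduction`, RED `RunningReduction` (stmt-QuantumFields-19978); registered skeleton «KTR» rev 8
(`pub/ym-beyond/p1-g19-files/Lines-KTR-r8.lean`, sha16 4d4e029b06d8e70b), PART 3 §4 «The enclosure algebra (pure real inequalities)»,
re-homed VERBATIM (namespace `…Cruxes.RunningReduction.KT` → `…Theorems.FemtoTransferGap.TraceDoor`) as the first proof file of the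
Theorems-side landing of the glue `TraceFormula → TwistedTraceScaling → OneSiteTail → DressedRitz → RunningReduction` (owner ym-beyond-p1
g19, CHILDREN-KIT: «land KTR PARTS 2–3, 5, 6, 8 as Theorems with the stubs as hypotheses»).

Content: `enclosure` — the two-sided product-form conclusion of RED
at one level from: the Kato–Temple door bound at the level and at the top, top capture, Rayleigh–Ritz ≤ min–max, sharp Ritz ratios
against the one-site values, and the coarse one-site lower law, under the smallness conditions `C₁λ ≤ g/8`, `Aλx ≤ 1/2`
(`l = λ`, `x = λ/L`).  Pure real inequalities: no lattice object appears.

HONEST FRAMING: elementary real algebra serving the femto rung R2b1; nothing of RED, of the RG, or of Clay is proved here.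
-/

set_option autoImplicit false

noncomputable section

namespace Summit.QuantumFields.YangMills.Theorems.FemtoTransferGap.TraceDoor

/-! ## The enclosure algebra (skeleton PART 3 §4, VERBATIM) -/

/-- **Enclosure algebra** of the Kato–Temple line (pure real inequalities; `l = λ`, `x = λ/L`; skeleton «KTR» PART 3 §4 VERBATIM).
Inputs: the door bounds `hdoorj`/`hdoor0` (`λ_j ≤ m_j + ρ/(m_k − θ)` once `θ < m_k`), top capture `hcap`, Ritz ≤ min–max `hm0`/`hmj`,
sharp Ritz ratios `hia_j`/`hib_j`/`hib_k` against the one-site values `μ`, the coarse one-site lower law `hone_j`/`hone_k`, and the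
smallness conditions `hs1`/`hs3`.  Output: RED's product-form two-sided bound at level `j` with constant `Cf = C₁ + A·E + 2A`.
[cite: Kato1949, Lemma 2, Thm 1] [cite: Luscher1983, §3] -/
theorem enclosure
    {lam0v lamj m0 mj mk mu0 muj muk θ ρ x l C1 g Dk Dj A E Cf : ℝ}
    (hl0 : 0 < lam0v) (hmu0 : 0 < mu0) (hx : 0 < x) (hx2 : x ≤ 2) (hl : 0 < l)
    (hC1 : 1 ≤ C1) (hg : 0 < g) (hDk : 0 ≤ Dk) (hDj : Dj ≤ Dk)
    (hA : A = 4 * C1 / g * Real.exp (2 * (Dk + g / 2))) (hE : E = Real.exp (2 * (Dk + g)))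
    (hCf : Cf = C1 + A * E + 2 * A)
    (hs1 : C1 * l ≤ g / 8) (hs3 : A * l * x ≤ 1 / 2)
    (hθ : θ = Real.exp (-((Dk + g / 2) * x)) * lam0v)
    (hρ : ρ = C1 * (l * x ^ 2) * m0 ^ 2)
    (hdoorj : θ < mk → lamj ≤ mj + ρ / (mk - θ))
    (hdoor0 : θ < mk → lam0v ≤ m0 + ρ / (mk - θ))
    (hcap : lam0v ≤ Real.exp (g / 16 * x) * m0) (hm0 : m0 ≤ lam0v) (hmj : mj ≤ lamj)
    (hia_j : mj * mu0 ≤ Real.exp (C1 * (l * x)) * (muj * m0))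
    (hib_j : muj * m0 ≤ Real.exp (C1 * (l * x)) * (mj * mu0))
    (hib_k : muk * m0 ≤ Real.exp (C1 * (l * x)) * (mk * mu0))
    (hone_j : Real.exp (-((Dj + g / 16) * x)) * mu0 ≤ muj)
    (hone_k : Real.exp (-((Dk + g / 16) * x)) * mu0 ≤ muk) :
    lamj * mu0 ≤ Real.exp (Cf * (l * x)) * (muj * lam0v) ∧
      muj * lam0v ≤ Real.exp (Cf * (l * x)) * (lamj * mu0) := by
  set d : ℝ := Dk + g / 2 with hd
  have hC1pos : 0 < C1 := by linarith
  have hlx : 0 < l * x := mul_pos hl hx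
  have hd0 : 0 ≤ d := by rw [hd]; linarith
  have hA0 : 0 ≤ A := by
    rw [hA]; exact mul_nonneg (div_nonneg (by linarith) hg.le) (Real.exp_pos _).le
  have hE1 : 1 ≤ E := by rw [hE]; exact Real.one_le_exp (by linarith only [hDk, hg])
  -- m0 > 0
  have hm0pos : 0 < m0 := by
    by_contra h
    push Not at h
    have h' : Real.exp (g / 16 * x) * m0 ≤ 0 :=
      mul_nonpos_of_nonneg_of_nonpos (Real.exp_pos _).le h
    linarith only [hl0, hcap, h']
  -- m0 ≥ e^{-(g/16)x} lam0v
  have hm0low : Real.exp (-(g / 16 * x)) * lam0v ≤ m0 := by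
    have h1 := mul_le_mul_of_nonneg_left hcap (Real.exp_pos (-(g / 16 * x))).le
    have h2 : Real.exp (-(g / 16 * x)) * (Real.exp (g / 16 * x) * m0) = m0 := by
      rw [← mul_assoc, ← Real.exp_add]; simp
    linarith only [h1, h2]
  -- muk > 0, muj > 0
  have hmukpos : 0 < muk := lt_of_lt_of_le (mul_pos (Real.exp_pos _) hmu0) hone_k
  have hmujpos : 0 < muj := lt_of_lt_of_le (mul_pos (Real.exp_pos _) hmu0) hone_j
  -- Step 2: mk ≥ e^{-(Dk+g/4)x} lam0v
  have hexp1 : Real.exp (C1 * (l * x)) * Real.exp (-((Dk + g / 4) * x)) ≤ Real.exp (-((Dk + g / 8) * x)) := by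
    rw [← Real.exp_add]
    apply Real.exp_le_exp.mpr
    have : C1 * l * x ≤ g / 8 * x := mul_le_mul_of_nonneg_right hs1 hx.le
    nlinarith
  have hmk : Real.exp (-((Dk + g / 4) * x)) * lam0v ≤ mk := by
    -- product of the two lower bounds
    have hprod : (Real.exp (-((Dk + g / 16) * x)) * mu0) * (Real.exp (-(g / 16 * x)) * lam0v) ≤ muk * m0 :=
      mul_le_mul hone_k hm0low (mul_nonneg (Real.exp_pos _).le hl0.le) hmukpos.le
    have hcomb : Real.exp (-((Dk + g / 16) * x)) * Real.exp (-(g / 16 * x)) = Real.exp (-((Dk + g / 8) * x)) := by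
      rw [← Real.exp_add]; congr 1; ring
    have h3 : mu0 * (Real.exp (-((Dk + g / 8) * x)) * lam0v) ≤ mu0 * (Real.exp (C1 * (l * x)) * mk) := by
      have : (Real.exp (-((Dk + g / 16) * x)) * mu0) * (Real.exp (-(g / 16 * x)) * lam0v)
          = mu0 * (Real.exp (-((Dk + g / 8) * x)) * lam0v) := by rw [← hcomb]; ring
      rw [← this]
      calc _ ≤ muk * m0 := hprod
        _ ≤ Real.exp (C1 * (l * x)) * (mk * mu0) := hib_k
        _ = mu0 * (Real.exp (C1 * (l * x)) * mk) := by ring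
    have h4 : Real.exp (-((Dk + g / 8) * x)) * lam0v ≤ Real.exp (C1 * (l * x)) * mk :=
      le_of_mul_le_mul_left h3 hmu0
    have h5 : Real.exp (C1 * (l * x)) * (Real.exp (-((Dk + g / 4) * x)) * lam0v)
        ≤ Real.exp (C1 * (l * x)) * mk := by
      calc Real.exp (C1 * (l * x)) * (Real.exp (-((Dk + g / 4) * x)) * lam0v)
          = (Real.exp (C1 * (l * x)) * Real.exp (-((Dk + g / 4) * x))) * lam0v := by ring
        _ ≤ Real.exp (-((Dk + g / 8) * x)) * lam0v := mul_le_mul_of_nonneg_right hexp1 hl0.le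
        _ ≤ _ := h4
    exact le_of_mul_le_mul_left h5 (Real.exp_pos _)
  -- Step 3: θ < mk and the gap
  have hθlt : θ < Real.exp (-((Dk + g / 4) * x)) * lam0v := by
    rw [hθ]
    apply mul_lt_mul_of_pos_right _ hl0
    apply Real.exp_lt_exp.mpr
    have e : d * x = Dk * x + g / 2 * x := by rw [hd]; ring
    linarith only [mul_pos hg hx, e]
  have hθmk : θ < mk := lt_of_lt_of_le hθlt hmk
  set G : ℝ := lam0v * Real.exp (-(d * x)) * (g / 4 * x) with hG
  have hGpos : 0 < G := by positivity
  have hgap : G ≤ mk - θ := by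
    have h1 : g / 4 * x ≤ Real.exp (g / 4 * x) - 1 := by linarith [Real.add_one_le_exp (g / 4 * x)]
    have h2 : Real.exp (-(d * x)) * Real.exp (g / 4 * x) = Real.exp (-((Dk + g / 4) * x)) := by
      rw [← Real.exp_add]; congr 1; rw [hd]; ring
    have h3 : G ≤ lam0v * (Real.exp (-((Dk + g / 4) * x)) - Real.exp (-(d * x))) := by
      rw [hG, ← h2]
      have : lam0v * (Real.exp (-(d * x)) * Real.exp (g / 4 * x) - Real.exp (-(d * x)))
          = lam0v * Real.exp (-(d * x)) * (Real.exp (g / 4 * x) - 1) := by ring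
      rw [this]
      exact mul_le_mul_of_nonneg_left h1 (by positivity)
    have h4 : lam0v * (Real.exp (-((Dk + g / 4) * x)) - Real.exp (-(d * x))) ≤ mk - θ := by
      rw [hθ]
      have e : lam0v * (Real.exp (-((Dk + g / 4) * x)) - Real.exp (-(d * x)))
          = Real.exp (-((Dk + g / 4) * x)) * lam0v - Real.exp (-(d * x)) * lam0v := by ring
      rw [e]
      linarith only [hmk]
    exact h3.trans h4
  -- Step 4: the door error ρ/(mk-θ) ≤ A l x m0 ≤ A l x lam0v
  have hρ0 : 0 ≤ ρ := by rw [hρ]; positivity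
  have herr : ρ / (mk - θ) ≤ A * l * x * m0 := by
    have h1 : ρ / (mk - θ) ≤ ρ / G := div_le_div_of_nonneg_left hρ0 hGpos hgap
    have h2 : ρ ≤ A * l * x * m0 * G := by
      have hAG : A * l * x * m0 * G = C1 * (l * x ^ 2) * (m0 * lam0v) * (Real.exp (2 * d) * Real.exp (-(d * x))) := by
        rw [hA, hG, hd]; field_simp
      rw [hAG, hρ]
      have hm0sq : m0 ^ 2 ≤ m0 * lam0v := by rw [sq]; exact mul_le_mul_of_nonneg_left hm0 hm0pos.le
      have hee : (1 : ℝ) ≤ Real.exp (2 * d) * Real.exp (-(d * x)) := by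
        rw [← Real.exp_add]; exact Real.one_le_exp (by linarith only [mul_nonneg hd0 (sub_nonneg.mpr hx2)])
      calc C1 * (l * x ^ 2) * m0 ^ 2 = C1 * (l * x ^ 2) * m0 ^ 2 * 1 := by ring
        _ ≤ C1 * (l * x ^ 2) * (m0 * lam0v) * (Real.exp (2 * d) * Real.exp (-(d * x))) :=
          mul_le_mul (mul_le_mul_of_nonneg_left hm0sq (by positivity)) hee zero_le_one (by positivity)
    have h3 : ρ / G ≤ A * l * x * m0 := by rw [div_le_iff₀ hGpos]; exact h2
    exact h1.trans h3
  have herr' : ρ / (mk - θ) ≤ A * l * x * lam0v := by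
    have : A * l * x * m0 ≤ A * l * x * lam0v := mul_le_mul_of_nonneg_left hm0 (by positivity)
    exact herr.trans this
  have hAlx0 : 0 ≤ A * l * x := by positivity
  -- Step 5: UPPER
  have hmu0_le : mu0 ≤ Real.exp ((Dj + g / 16) * x) * muj := by
    have h1 := mul_le_mul_of_nonneg_left hone_j (Real.exp_pos ((Dj + g / 16) * x)).le
    have h2 : Real.exp ((Dj + g / 16) * x) * (Real.exp (-((Dj + g / 16) * x)) * mu0) = mu0 := by
      rw [← mul_assoc, ← Real.exp_add]; simp
    linarith only [h1, h2]
  have hEx : Real.exp ((Dj + g / 16) * x) ≤ E := by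
    rw [hE]; apply Real.exp_le_exp.mpr
    have e1 : (Dj + g / 16) * x ≤ (Dk + g) * x := mul_le_mul_of_nonneg_right (by linarith) hx.le
    have e2 : (Dk + g) * x ≤ (Dk + g) * 2 := mul_le_mul_of_nonneg_left hx2 (by linarith)
    linarith only [e1, e2]
  have hmu0_le' : mu0 ≤ E * muj := hmu0_le.trans (mul_le_mul_of_nonneg_right hEx hmujpos.le)
  have hexpC1 : 1 ≤ Real.exp (C1 * (l * x)) := Real.one_le_exp (by positivity)
  have hup : lamj * mu0 ≤ Real.exp (Cf * (l * x)) * (muj * lam0v) := by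
    have h1 : lamj ≤ mj + A * l * x * lam0v := by linarith only [hdoorj hθmk, herr']
    have h2 : lamj * mu0 ≤ mj * mu0 + A * l * x * lam0v * mu0 := by
      calc lamj * mu0 ≤ (mj + A * l * x * lam0v) * mu0 := mul_le_mul_of_nonneg_right h1 hmu0.le
        _ = _ := by ring
    have h3 : mj * mu0 ≤ Real.exp (C1 * (l * x)) * (muj * lam0v) :=
      hia_j.trans (mul_le_mul_of_nonneg_left (mul_le_mul_of_nonneg_left hm0 hmujpos.le) (Real.exp_pos _).le)
    have h4 : A * l * x * lam0v * mu0 ≤ A * l * x * lam0v * (E * muj) :=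
      mul_le_mul_of_nonneg_left hmu0_le' (by positivity)
    -- combine: lamj mu0 ≤ (muj lam0v) (exp(C1 lx) + A E l x) ≤ (muj lam0v) exp(C1 lx) (1 + A E l x) ≤ (muj lam0v) exp((C1 + A E) l x)
    have h5 : lamj * mu0 ≤ (muj * lam0v) * (Real.exp (C1 * (l * x)) * (1 + A * E * (l * x))) := by
      have : (muj * lam0v) * (Real.exp (C1 * (l * x)) + A * E * (l * x))
          ≤ (muj * lam0v) * (Real.exp (C1 * (l * x)) * (1 + A * E * (l * x))) := by
        apply mul_le_mul_of_nonneg_left _ (by positivity)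
        have hAE : 0 ≤ A * E * (l * x) := by positivity
        nlinarith only [hexpC1, hAE]
      linarith only [h2, h3, h4, this]
    have h6 : 1 + A * E * (l * x) ≤ Real.exp (A * E * (l * x)) := by
      linarith [Real.add_one_le_exp (A * E * (l * x))]
    have h7 : Real.exp (C1 * (l * x)) * (1 + A * E * (l * x)) ≤ Real.exp (Cf * (l * x)) := by
      calc Real.exp (C1 * (l * x)) * (1 + A * E * (l * x))
          ≤ Real.exp (C1 * (l * x)) * Real.exp (A * E * (l * x)) := mul_le_mul_of_nonneg_left h6 (Real.exp_pos _).le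
        _ = Real.exp ((C1 + A * E) * (l * x)) := by rw [← Real.exp_add]; ring_nf
        _ ≤ Real.exp (Cf * (l * x)) := by
          apply Real.exp_le_exp.mpr; rw [hCf]; linarith only [mul_nonneg hA0 hlx.le]
    calc lamj * mu0 ≤ (muj * lam0v) * (Real.exp (C1 * (l * x)) * (1 + A * E * (l * x))) := h5
      _ ≤ (muj * lam0v) * Real.exp (Cf * (l * x)) := mul_le_mul_of_nonneg_left h7 (by positivity)
      _ = _ := by ring
  -- Step 6: LOWER
  have hlow : muj * lam0v ≤ Real.exp (Cf * (l * x)) * (lamj * mu0) := by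
    have h1 : lam0v - A * l * x * lam0v ≤ m0 := by linarith only [hdoor0 hθmk, herr']
    have h2 : Real.exp (-(2 * (A * l * x))) * lam0v ≤ m0 := by
      -- `e^{−2y} ≤ 1 − y` on `[0, 1/2]` (tangent line; = tree `Literature…Nicolas.exp_neg_two_mul_le`, inlined to keep the import cone physical)
      have this : Real.exp (-(2 * (A * l * x))) ≤ 1 - A * l * x := by
        have e1 : 2 * (A * l * x) + 1 ≤ Real.exp (2 * (A * l * x)) := Real.add_one_le_exp _
        have e2 : 0 < Real.exp (2 * (A * l * x)) := Real.exp_pos _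
        have e3 : 0 ≤ 1 - A * l * x := by linarith only [hs3]
        have e4 : (2 * (A * l * x) + 1) * (1 - A * l * x) ≤ Real.exp (2 * (A * l * x)) * (1 - A * l * x) :=
          mul_le_mul_of_nonneg_right e1 e3
        have e5 : (2 * (A * l * x) + 1) * (1 - A * l * x) = 1 + (A * l * x) * (1 - 2 * (A * l * x)) := by ring
        have e6 : 0 ≤ (A * l * x) * (1 - 2 * (A * l * x)) := mul_nonneg hAlx0 (by linarith only [hs3])
        rw [Real.exp_neg, inv_le_iff_one_le_mul₀ e2]
        linarith only [e4, e5, e6]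
      calc Real.exp (-(2 * (A * l * x))) * lam0v ≤ (1 - A * l * x) * lam0v := mul_le_mul_of_nonneg_right this hl0.le
        _ = lam0v - A * l * x * lam0v := by ring
        _ ≤ m0 := h1
    have hmjpos : 0 < mj := by
      have ha : 0 < Real.exp (C1 * (l * x)) * (mj * mu0) := lt_of_lt_of_le (mul_pos hmujpos hm0pos) hib_j
      have hb : 0 < mj * mu0 := by
        by_contra h; push Not at h
        have hc := mul_nonpos_of_nonneg_of_nonpos (Real.exp_pos (C1 * (l * x))).le h
        linarith only [ha, hc]
      by_contra h'; push Not at h'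
      have hc : mu0 * mj ≤ 0 := mul_nonpos_of_nonneg_of_nonpos hmu0.le h'
      linarith only [hb, hc]
    have h3 : muj * (Real.exp (-(2 * (A * l * x))) * lam0v) ≤ muj * m0 := mul_le_mul_of_nonneg_left h2 hmujpos.le
    have h4 : muj * m0 ≤ Real.exp (C1 * (l * x)) * (lamj * mu0) :=
      hib_j.trans (mul_le_mul_of_nonneg_left (mul_le_mul_of_nonneg_right hmj hmu0.le) (Real.exp_pos _).le)
    -- muj lam0v = exp(2Alx) * (muj * exp(-2Alx) lam0v) ≤ exp(2Alx) exp(C1 lx) lamj mu0 ≤ exp(Cf lx) lamj mu0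
    have h5 : muj * lam0v = Real.exp (2 * (A * l * x)) * (muj * (Real.exp (-(2 * (A * l * x))) * lam0v)) := by
      have : Real.exp (2 * (A * l * x)) * Real.exp (-(2 * (A * l * x))) = 1 := by
        rw [← Real.exp_add]; simp
      calc muj * lam0v = (Real.exp (2 * (A * l * x)) * Real.exp (-(2 * (A * l * x)))) * (muj * lam0v) := by rw [this]; ring
        _ = _ := by ring
    have hlamjmu0 : 0 ≤ lamj * mu0 := mul_nonneg (hmjpos.le.trans hmj) hmu0.le
    have h6 : Real.exp (2 * (A * l * x)) * Real.exp (C1 * (l * x)) ≤ Real.exp (Cf * (l * x)) := by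
      rw [← Real.exp_add]; apply Real.exp_le_exp.mpr; rw [hCf]
      linarith only [mul_nonneg (mul_nonneg hA0 (zero_le_one.trans hE1)) hlx.le]
    calc muj * lam0v = Real.exp (2 * (A * l * x)) * (muj * (Real.exp (-(2 * (A * l * x))) * lam0v)) := h5
      _ ≤ Real.exp (2 * (A * l * x)) * (Real.exp (C1 * (l * x)) * (lamj * mu0)) :=
          mul_le_mul_of_nonneg_left (h3.trans h4) (Real.exp_pos _).le
      _ = (Real.exp (2 * (A * l * x)) * Real.exp (C1 * (l * x))) * (lamj * mu0) := by ring
      _ ≤ Real.exp (Cf * (l * x)) * (lamj * mu0) := mul_le_mul_of_nonneg_right h6 hlamjmu0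
  exact ⟨hup, hlow⟩

end Summit.QuantumFields.YangMills.Theorems.FemtoTransferGap.TraceDoor

end
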